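/-
Copyright: harness tree, Literature layer (sorry-free). b2b-lace enum1-g52 (ENUMERATION SHARD A gen 52),
node KU-SEP-SEED-K2: composition of the PRODUCT-ROW twisted SEEDCERT soundness theorem with the product row truncation.
-/
import Literature.Probability.FitznerVanDerHofstad2017.SrwTwistProdCertSound
import Literature.Probability.FitznerVanDerHofstad2017.SrwTwistProductSliceBudget
import HarnessLib

/-!
# Product-row twisted SEEDCERT: the certified bracket of a product cosine-power twisted seed

Composition of `PrCert.soundP` (`SrwTwistProdCertSound`: a passing product certificate brackets the
literal product-row object
`R_{n+1} = (n!)⁻¹ (∫_0^∞ τ^n e^{-τ} Re Π_μ (Σ_{j≤J} ε_j (Σ_s C(a_μ,s) 2^{-a_μ} I_{jm-(2s-a_μ)}(τ/D)) c_j) dτ)/(2π)^D`,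
`c_j = 2π i^j Q_j/qden`, for every exponent vector `a` unrolling the certificate's class list) with the
row-truncation / coefficient-substitution estimate `abs_srwTwist_prodCosPow_sub_prodRowObj_le`
(`SrwTwistProductSliceBudget`: `|Tw^{Π cos^{a_μ}}_{n+1}(m e_i; β) - R_{n+1}| ≤ E`, `E` an explicit nonnegative
combination of plain seeds and Bessel tails, at the `μ`-independent table `c'_{μ,j} = c_j`): for every
certificate `c` with `c.checkP D = true`, every `a : Fin D → ℕ` with `List.ofFn a = unroll c.cls`, every
`n ≤ 3` with `2(n+1)+1 ≤ D`, every axis `i`, every `β` and every ball parameter `M ≤ m` with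
`amax ≤ (J+1)M`,

  `lo (n+1) - E ≤ Tw^{Π_μ cos^{a_μ}}_{n+1}(m e_i; β) ≤ hi (n+1) + E`,   `E = PrCert.truncErrP c D n β M`.

Generic in the dimension; number-free; no instance in this module.
[cite: FitznerVanDerHofstad2016NoBLE, §5.1.1 (5.2)–(5.5) pp. 1089–1090]
-/

set_option Elab.async false

namespace Literature.Probability.FitznerVanDerHofstad2017.SeedCert

open Real MeasureTheory Set Finset
open Literature.Probability.LatticeModels (besselI)
open Literature.Analysis.FunctionSpaces (besselJ)
open scoped Nat

/-- Members of `unroll cls` are class exponents. [cite: FitznerVanDerHofstad2016NoBLE, §5.1.1 (5.4)–(5.5) pp. 1089–1090] -/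
theorem mem_unroll {x : ℕ} : ∀ cls : List (ℕ × ℕ), x ∈ unroll cls → ∃ ap ∈ cls, x = ap.1
  | [], h => by simp [unroll] at h
  | (a, p) :: t, h => by
      rw [unroll, List.mem_append, List.mem_replicate] at h
      rcases h with ⟨-, rfl⟩ | h
      · exact ⟨(x, p), List.mem_cons_self, rfl⟩
      · obtain ⟨ap, hap, hx⟩ := mem_unroll t h
        exact ⟨ap, List.mem_cons_of_mem _ hap, hx⟩

namespace PrCert

variable (c : PrCert) (D : ℕ)

/-- An exponent vector unrolling the class list is bounded by `amax`. [cite: FitznerVanDerHofstad2016NoBLE, §5.1.1 (5.4)–(5.5) pp. 1089–1090] -/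
theorem apply_le_amax (a : Fin D → ℕ) (ha : List.ofFn a = unroll c.cls) (μ : Fin D) : a μ ≤ c.amax := by
  have hx : a μ ∈ unroll c.cls := ha ▸ List.mem_ofFn.mpr ⟨μ, rfl⟩
  obtain ⟨ap, hap, hx'⟩ := mem_unroll c.cls hx
  rw [hx']
  exact c.le_amax hap

/-- The row-truncation + coefficient-substitution error of `abs_srwTwist_prodCosPow_sub_prodRowObj_le` for the
certificate's row (`J = c.J`, `m = c.m`, `amax = c.amax`, `c'_{μ,j} = c.cT j`) at twist parameter `β`, seed
index `n+1` and ball parameter `M`: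
`Σ_{k<D} C(D,k+1) (2δ_J(β/D))^{k+1} I_{n+1,0}(((J+1)M-amax)·(e_0+…+e_k)) + ((α'+η)^D - α'^D)/(2π)^D · I_{n+1,0}(0)`,
`δ_J(y) = Σ_{l≥0} |J_{l+J+1}(y)|`, `α' = Σ_j ε_j ‖c_j‖`, `η = Σ_j ε_j ‖2π i^j J_j(β/D) - c_j‖`.
[cite: FitznerVanDerHofstad2016NoBLE, §5.1.1 (5.2)–(5.5) pp. 1089–1090] -/
noncomputable def truncErrP (n : ℕ) (β : ℝ) (M : ℕ) : ℝ :=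
  (∑ k ∈ Finset.range D, (D.choose (k + 1) : ℝ)
      * (2 * ∑' l : ℕ, |besselJ (l + c.J + 1) (β / D)|) ^ (k + 1)
      * srwI D (n + 1) 0
          (fun μ : Fin D => if (μ : ℕ) < k + 1 then ((((c.J + 1) * M - c.amax : ℕ)) : ℤ) else 0))
    + (((∑ j ∈ Finset.range (c.J + 1), (if j = 0 then (1 : ℝ) else 2) * ‖c.cT j‖)
          + ∑ j ∈ Finset.range (c.J + 1), (if j = 0 then (1 : ℝ) else 2)
              * ‖2 * π * Complex.I ^ j * (besselJ j (β / D) : ℂ) - c.cT j‖) ^ D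
        - (∑ j ∈ Finset.range (c.J + 1), (if j = 0 then (1 : ℝ) else 2) * ‖c.cT j‖) ^ D) / (2 * π) ^ D
      * srwI D (n + 1) 0 (fun _ : Fin D => 0)

/-- **Certified two-sided bracket of a product cosine-power twisted seed.** If the Boolean certificate
check `c.checkP D` passes, then for every exponent vector `a` unrolling the class list, every `n ≤ 3` with
`2(n+1)+1 ≤ D`, every axis `i : Fin D`, every `β : ℝ` and every `M ≤ c.m` with `c.amax ≤ (c.J+1) M`:
`lo (n+1) - truncErrP ≤ Tw^{Π_μ cos^{a_μ}}_{n+1}(c.m · e_i; β) ≤ hi (n+1) + truncErrP`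
(`PrCert.soundP` composed with `abs_srwTwist_prodCosPow_sub_prodRowObj_le` at `c'_{μ,j} = c.cT j`, `m = c.m`,
`J = c.J`, `amax = c.amax`). [cite: FitznerVanDerHofstad2016NoBLE, §5.1.1 (5.2)–(5.5) pp. 1089–1090] -/
theorem srwTwistProdCosPow_mem_of_checkP (h : c.checkP D = true) (a : Fin D → ℕ)
    (ha : List.ofFn a = unroll c.cls) (n : ℕ) (hn : n ≤ 3) (hd : 2 * (n + 1) + 1 ≤ D) (i : Fin D)
    (β : ℝ) (M : ℕ) (hM : M ≤ c.m) (hamax : c.amax ≤ (c.J + 1) * M) :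
    ((c.lo (n + 1) : ℚ) : ℝ) - c.truncErrP D n β M
        ≤ srwTwist D (n + 1) (fun k => ∏ μ, Real.cos (k μ) ^ a μ) (Pi.single i (c.m : ℤ)) β ∧
    srwTwist D (n + 1) (fun k => ∏ μ, Real.cos (k μ) ^ a μ) (Pi.single i (c.m : ℤ)) β
        ≤ ((c.hi (n + 1) : ℚ) : ℝ) + c.truncErrP D n β M := by
  obtain ⟨h1, -, -, -, -⟩ := c.checkP_spec D h
  have hp := c.paramsP_of_paramsOKP D h1
  have hm : ((c.m : ℕ) : ℤ) ≠ 0 := by exact_mod_cast hp.toT.m_pos.ne'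
  have hM' : M ≤ ((c.m : ℕ) : ℤ).natAbs := by simpa using hM
  have hs := c.soundP D h a ha (n + 1) (by omega) (by omega)
  simp only [Nat.add_sub_cancel] at hs
  have ht := abs_srwTwist_prodCosPow_sub_prodRowObj_le (d := D) n hd i hm β a c.J M c.amax hM'
    (c.apply_le_amax D a ha) hamax (fun _ => c.cT)
  rw [Finset.prod_const, Finset.prod_const, Finset.card_univ, Fintype.card_fin, abs_sub_le_iff] at ht
  obtain ⟨ht1, ht2⟩ := ht
  obtain ⟨hs1, hs2⟩ := hs
  simp only [truncErrP]
  constructor <;> linarith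

/-- The five-conjunct form of `srwTwistProdCosPow_mem_of_checkP` (the shape a kernel-decided instance
supplies). [cite: FitznerVanDerHofstad2016NoBLE, §5.1.1 (5.2)–(5.5) pp. 1089–1090] -/
theorem srwTwistProdCosPow_mem_of_parts (h1 : c.paramsOKP D = true) (h2 : c.toTwCert.finalCheckT D = true)
    (h3 : c.poissonCheckP D = true) (h4 : c.tailCheckIM D = true) (h5 : c.tailCheckIB D = true)
    (a : Fin D → ℕ) (ha : List.ofFn a = unroll c.cls) (n : ℕ) (hn : n ≤ 3) (hd : 2 * (n + 1) + 1 ≤ D)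
    (i : Fin D) (β : ℝ) (M : ℕ) (hM : M ≤ c.m) (hamax : c.amax ≤ (c.J + 1) * M) :
    ((c.lo (n + 1) : ℚ) : ℝ) - c.truncErrP D n β M
        ≤ srwTwist D (n + 1) (fun k => ∏ μ, Real.cos (k μ) ^ a μ) (Pi.single i (c.m : ℤ)) β ∧
    srwTwist D (n + 1) (fun k => ∏ μ, Real.cos (k μ) ^ a μ) (Pi.single i (c.m : ℤ)) β
        ≤ ((c.hi (n + 1) : ℚ) : ℝ) + c.truncErrP D n β M :=
  c.srwTwistProdCosPow_mem_of_checkP D (c.checkP_intro D h1 h2 h3 h4 h5) a ha n hn hd i β M hM hamax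

/-- `truncErrP` is nonnegative (so the bracket is never vacuous by sign).
[cite: FitznerVanDerHofstad2016NoBLE, §5.1.1 (5.2)–(5.5) pp. 1089–1090] -/
theorem truncErrP_nonneg (h : c.checkP D = true) (a : Fin D → ℕ) (ha : List.ofFn a = unroll c.cls)
    (n : ℕ) (hd : 2 * (n + 1) + 1 ≤ D) (i : Fin D) (β : ℝ) (M : ℕ) (hM : M ≤ c.m)
    (hamax : c.amax ≤ (c.J + 1) * M) : 0 ≤ c.truncErrP D n β M := by
  obtain ⟨h1, -, -, -, -⟩ := c.checkP_spec D h
  have hp := c.paramsP_of_paramsOKP D h1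
  have hm : ((c.m : ℕ) : ℤ) ≠ 0 := by exact_mod_cast hp.toT.m_pos.ne'
  have hM' : M ≤ ((c.m : ℕ) : ℤ).natAbs := by simpa using hM
  have ht := abs_srwTwist_prodCosPow_sub_prodRowObj_le (d := D) n hd i hm β a c.J M c.amax hM'
    (c.apply_le_amax D a ha) hamax (fun _ => c.cT)
  rw [Finset.prod_const, Finset.prod_const, Finset.card_univ, Fintype.card_fin] at ht
  have := (abs_nonneg _).trans ht
  simpa only [truncErrP] using this

end PrCert

end Literature.Probability.FitznerVanDerHofstad2017.SeedCert
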